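import Literature.RingTheory.Henselian.FiniteAlgebraProductOfLocalizations
import Mathlib.RingTheory.AdjoinRoot
import Mathlib.RingTheory.Nakayama
import HarnessLib

/-!
# Henselian local rings: the converse «idempotents lift ⇒ henselian» and henselian local factors (Stacks 04GG, 04GH)

Topic `Literature/RingTheory/Henselian`; namespace `Literature.RingTheory.Henselian`.  PROOF FILE (theorems only; no
definition, no named fact, no instance, no `sorry`).  Cell `hodgecm-mathlib` (D-0151); idle-hand generic capital continuing the
henselian road ★ `Henselian/EtaleSectionsFactorization` (04GG (1) ⇒ (8) ⇒ (4)) and ★ `Henselian/FiniteAlgebraProductOfLocalizations`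
(04GG (4) ⇒ (10), 04GH first half), closing the TODO of Mathlib's `RingTheory/Henselian.lean` («more equivalent characterisations»).

* §1 **`henselianLocalRing_of_forall_exists_isIdempotentElem`** — [Stacks 04GG (10) ⇒ (1), idempotent form]: a local ring `R` such
  that, for every monic `f ∈ R[X]`, idempotents of `(R[X]/(f)) ⧸ 𝔪` lift to `R[X]/(f)` IS henselian.  Proof: for a simple root `ā₀` of
  `f̄ = (X - ā₀)·ḡ`, Bézout `ū(X - ā₀) + v̄ḡ = 1` over the residue field; the class of `(vG)(x)` (any lifts `v, G`) is an idempotent of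
  `(R[X]/(f)) ⧸ 𝔪`; lift it to `e`; the corner `B = (R[X]/(f)) ⧸ (1 - e)` receives `R` SURJECTIVELY (Nakayama: `x ≡ a₀ (mod 𝔪B)`) and
  INJECTIVELY (if `r ≠ 0` dies then `r·e = 0`, so the power-basis coordinates of `e` are non-units and the evaluation `x ↦ ā₀` would
  kill `e`, whereas it sends `e ↦ (v̄ḡ)(ā₀) = 1`); the preimage of `x` is the required root.
* §2 **`henselianLocalRing_quotient_span_one_sub`** — [Stacks 04GH, second half]: for `S` module-finite over a HENSELIAN local `R` and
  an idempotent `e ∈ S` with `S ⧸ (1 - e)` local, the corner `S ⧸ (1 - e)` is henselian (§1 for `T = S ⧸ (1 - e)`: idempotents of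
  `T[X]/(f) ⧸ 𝔪_T` lift to `T[X]/(f) ⧸ 𝔪_R` along a nilpotent kernel and then to `T[X]/(f)` by ★
  `Henselian.exists_isIdempotentElem_mk_eq`); with ★ `exists_completeOrthogonalIdempotents_isLocalRing`:
  **`exists_completeOrthogonalIdempotents_henselianLocalRing`** — «a finite algebra over a henselian local ring is a finite product
  of HENSELIAN local rings».

HC_CM is proved only modulo the 7 printed citations until rung 0 closes; this file is generic commutative algebra.

## References
* [StacksProject] The Stacks project, Tag 04GG = Algebra, Lemma 10.153.3, implication (10) ⇒ (1) and its printed proof («one of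
  the factors … is the quotient `κ[T]/(T - a₀)` … `A₁` is finite free of rank 1 … `R = A₁` … a root»); Tag 04GH = Lemma 10.153.4
  («if `R` is henselian and `S` is a finite `R`-algebra then `S` is a finite product of henselian local rings»).
-/

set_option autoImplicit false

noncomputable section

universe u v

open Polynomial IsLocalRing

namespace Literature.RingTheory.Henselian

variable {R : Type u} [CommRing R] [IsLocalRing R]

/-! ## §0 Plumbing: polynomials with coefficients in `𝔪` -/

/-- A polynomial whose reduction modulo `𝔪` vanishes evaluates into `𝔪S` in any `R`-algebra `S`. [folklore] -/
private theorem aeval_mem_map_of_map_residue_eq_zero {S : Type v} [CommRing S] [Algebra R S] (w : R[X])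
    (hw : w.map (residue R) = 0) (s : S) : aeval s w ∈ (maximalIdeal R).map (algebraMap R S) := by
  rw [aeval_eq_sum_range]
  refine Ideal.sum_mem _ fun i _ => ?_
  rw [Algebra.smul_def]
  refine Ideal.mul_mem_right _ _ (Ideal.mem_map_of_mem _ ?_)
  rw [← residue_eq_zero_iff, ← Polynomial.coeff_map, hw, coeff_zero]

/-! ## §1 Idempotent lifting for the finite free algebras `R[X]/(f)` implies henselian — Stacks 04GG (10) ⇒ (1) -/

/-- **[Stacks 04GG (10) ⇒ (1)] in idempotent form.**  Let `R` be a local ring such that for every MONIC `f ∈ R[X]` every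
idempotent of `R[X]/(f) ⧸ 𝔪·(R[X]/(f))` lifts to an idempotent of `R[X]/(f)`.  Then `R` is henselian.
(Printed proof: the factor of `κ[X]/(f̄)` at a simple root `ā₀` is `κ[X]/(X - ā₀) ≅ κ`; the corresponding corner of `R[X]/(f)` is
`≅ R`, and the image of `X` in it is the root.) [cite: StacksProject, Tag 04GG (10)⇒(1), proof] -/
theorem henselianLocalRing_of_forall_exists_isIdempotentElem
    (h : ∀ f : R[X], f.Monic →
      ∀ ē : AdjoinRoot f ⧸ (maximalIdeal R).map (algebraMap R (AdjoinRoot f)), IsIdempotentElem ē →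
        ∃ e : AdjoinRoot f, IsIdempotentElem e ∧ Ideal.Quotient.mk _ e = ē) :
    HenselianLocalRing R := by
  classical
  refine { toIsLocalRing := inferInstance, is_henselian := fun f hf a₀ hfa₀ hf'a₀ => ?_ }
  -- notation
  set κ := ResidueField R
  set A := AdjoinRoot f with hA
  set I : Ideal A := (maximalIdeal R).map (algebraMap R A) with hI
  set x : A := AdjoinRoot.root f with hx
  have hfx : aeval x f = 0 := by rw [hx, AdjoinRoot.aeval_eq, AdjoinRoot.mk_self]
  -- the residue picture: `f̄ = (X - ā₀) * ḡ`, `ḡ(ā₀) = f̄'(ā₀) ≠ 0`, Bézout `ū (X - ā₀) + v̄ ḡ = 1`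
  set fb := f.map (residue R) with hfb
  have hroot : fb.IsRoot (residue R a₀) := by
    rw [IsRoot.def, hfb, eval_map, eval₂_hom, residue_eq_zero_iff]
    exact hfa₀
  set gb := fb /ₘ (X - C (residue R a₀)) with hgb
  have hfg : (X - C (residue R a₀)) * gb = fb := mul_divByMonic_eq_iff_isRoot.2 hroot
  have hga₀ : gb.eval (residue R a₀) ≠ 0 := by
    have hd : fb.derivative.eval (residue R a₀) = gb.eval (residue R a₀) := by
      conv_lhs => rw [← hfg]
      rw [derivative_mul, derivative_sub, derivative_X, derivative_C, sub_zero, one_mul, eval_add, eval_mul, eval_sub,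
        eval_X, eval_C, sub_self, zero_mul, add_zero]
    rw [← hd, hfb, derivative_map, eval_map, eval₂_hom]
    exact (residue_ne_zero_iff_isUnit _).2 hf'a₀
  have hcop : IsCoprime (X - C (residue R a₀)) gb :=
    (irreducible_X_sub_C (residue R a₀)).coprime_iff_not_dvd.2 fun hdvd => hga₀ (dvd_iff_isRoot.1 hdvd)
  obtain ⟨ub, vb, huv⟩ := hcop
  -- lifts `u v G` of `ū v̄ ḡ`; `F := X - C a₀`
  obtain ⟨u, hu⟩ := Polynomial.map_surjective (residue R) residue_surjective ub
  obtain ⟨v, hv⟩ := Polynomial.map_surjective (residue R) residue_surjective vb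
  obtain ⟨G, hG⟩ := Polynomial.map_surjective (residue R) residue_surjective gb
  set F : R[X] := X - C a₀ with hF
  have hFmap : F.map (residue R) = X - C (residue R a₀) := by rw [hF, Polynomial.map_sub, map_X, map_C]
  have hFG : aeval x (F * G) ∈ I :=  by
    have hw : (F * G - f).map (residue R) = 0 := by rw [Polynomial.map_sub, Polynomial.map_mul, hFmap, hG, hfg, sub_self]
    have := aeval_mem_map_of_map_residue_eq_zero (F * G - f) hw x
    rwa [map_sub, hfx, sub_zero] at this
  have huv1 : aeval x (u * F + v * G) - 1 ∈ I := by
    have hw : (u * F + v * G - 1).map (residue R) = 0 := by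
      rw [Polynomial.map_sub, Polynomial.map_add, Polynomial.map_mul, Polynomial.map_mul, hu, hFmap, hv, hG, huv,
        Polynomial.map_one, sub_self]
    have := aeval_mem_map_of_map_residue_eq_zero (u * F + v * G - 1) hw x
    rwa [map_sub, map_one] at this
  -- the idempotent `ε̄ = class of (vG)(x)` and its lift `e`
  set y : A := aeval x (v * G) with hy
  have hyI : y * y - y ∈ I := by
    have h1 : y * y - y = y * (aeval x (u * F + v * G) - 1) - aeval x (u * v) * aeval x (F * G) := by
      simp only [hy, map_add, map_mul]; ring
    rw [h1]
    exact I.sub_mem (I.mul_mem_left _ huv1) (I.mul_mem_left _ hFG)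
  have hē : IsIdempotentElem (Ideal.Quotient.mk I y) := by
    rw [IsIdempotentElem, ← map_mul, Ideal.Quotient.mk_eq_mk_iff_sub_mem]
    exact hyI
  obtain ⟨e, he, hey⟩ := h f hf _ hē
  have heyI : e - y ∈ I := (Ideal.Quotient.mk_eq_mk_iff_sub_mem _ _).1 hey
  -- `(x - a₀) e ∈ 𝔪A`
  have hxe : (x - algebraMap R A a₀) * e ∈ I := by
    have h1 : (x - algebraMap R A a₀) * y = aeval x v * aeval x (F * G) := by
      simp only [hy, hF, map_mul, map_sub, aeval_X, aeval_C]
      ring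
    have h2 : (x - algebraMap R A a₀) * e = (x - algebraMap R A a₀) * (e - y) + aeval x v * aeval x (F * G) := by
      rw [← h1]; ring
    rw [h2]
    exact I.add_mem (I.mul_mem_left _ heyI) (I.mul_mem_left _ hFG)
  -- the evaluation `ev : A → κ`, `x ↦ ā₀`; it kills `𝔪A` and `1 - e`
  have hev₀ : f.eval₂ (residue R) (residue R a₀) = 0 := by rw [← eval_map]; exact hroot
  set ev : A →+* κ := AdjoinRoot.lift (residue R) (residue R a₀) hev₀ with hev
  have hev_of : ∀ r : R, ev (algebraMap R A r) = residue R r := fun r => by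
    rw [AdjoinRoot.algebraMap_eq]; exact AdjoinRoot.lift_of hev₀
  have hevI : ∀ z ∈ I, ev z = 0 := by
    intro z hz
    have : I ≤ RingHom.ker ev := by
      rw [hI, Ideal.map_le_iff_le_comap]
      intro r hr
      rw [Ideal.mem_comap, RingHom.mem_ker, hev_of, residue_eq_zero_iff]
      exact hr
    exact this hz
  have hev_aeval : ∀ p : R[X], ev (aeval x p) = (p.map (residue R)).eval (residue R a₀) := fun p => by
    rw [hx, AdjoinRoot.aeval_eq, hev, AdjoinRoot.lift_mk, eval_map]
  have heve : ev e = 1 := by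
    have h1 : ev e = ev y := by
      rw [← sub_eq_zero, ← map_sub]; exact hevI _ heyI
    rw [h1, hy, hev_aeval, Polynomial.map_mul, hv, hG]
    have h2 := congrArg (eval (residue R a₀)) huv
    rw [eval_add, eval_mul, eval_mul, eval_sub, eval_X, eval_C, sub_self, mul_zero, zero_add, eval_one] at h2
    rw [eval_mul, h2]
  -- the corner `B = A ⧸ (1 - e)` and `φ : R → B`
  set J : Ideal A := Ideal.span {1 - e} with hJ
  set π : A →+* A ⧸ J := Ideal.Quotient.mk J with hπ
  have hπe : π e = 1 := by
    rw [← sub_eq_zero, ← map_one π, ← map_sub, ← neg_sub, map_neg, neg_eq_zero, hπ, Ideal.Quotient.eq_zero_iff_mem]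
    exact Ideal.subset_span (Set.mem_singleton _)
  -- `ev` factors through `B`
  have hevJ : ∀ z ∈ J, ev z = 0 := by
    intro z hz
    have : J ≤ RingHom.ker ev := by
      rw [hJ, Ideal.span_le, Set.singleton_subset_iff, SetLike.mem_coe, RingHom.mem_ker, map_sub, map_one, heve, sub_self]
    exact this hz
  set evB : A ⧸ J →+* κ := Ideal.Quotient.lift J ev hevJ with hevB
  -- INJECTIVITY of `φ = algebraMap R (A ⧸ J)`
  have hinj : Function.Injective (algebraMap R (A ⧸ J)) := by
    rw [injective_iff_map_eq_zero]
    intro r hr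
    by_contra hr0
    -- `r • e = 0` in `A`
    have hre : r • e = 0 := by
      rw [IsScalarTower.algebraMap_apply R A (A ⧸ J), Ideal.Quotient.algebraMap_eq, Ideal.Quotient.eq_zero_iff_mem, hJ,
        Ideal.mem_span_singleton'] at hr
      obtain ⟨c, hc⟩ := hr
      rw [Algebra.smul_def, ← hc, mul_assoc, he.one_sub_mul_self, mul_zero]
    -- the power-basis coordinates of `e` are killed by `r`, hence non-units, hence in `𝔪`; so `ev e = 0`
    set pb := AdjoinRoot.powerBasis' hf with hpb
    have hcoord : ∀ i, r * pb.basis.repr e i = 0 := fun i => by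
      have := congrArg (fun z => pb.basis.repr z i) hre
      simpa only [map_smul, map_zero, Finsupp.smul_apply, smul_eq_mul, Finsupp.coe_zero, Pi.zero_apply] using this
    have hmem : ∀ i, pb.basis.repr e i ∈ maximalIdeal R := fun i => by
      by_contra hunit
      rw [mem_maximalIdeal, mem_nonunits_iff, not_not] at hunit
      have h' : pb.basis.repr e i * r = 0 := by rw [mul_comm]; exact hcoord i
      exact hr0 (hunit.mul_right_eq_zero.1 h')
    have heI : e ∈ I := by
      rw [← pb.basis.sum_repr e]
      refine I.sum_mem fun i _ => ?_
      rw [Algebra.smul_def]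
      exact I.mul_mem_right _ (Ideal.mem_map_of_mem _ (hmem i))
    exact one_ne_zero (heve.symm.trans (hevI e heI))
  -- SURJECTIVITY of `φ` (Nakayama: `x ≡ a₀` modulo `𝔪B`)
  set pb := AdjoinRoot.powerBasis' hf with hpb
  haveI : Module.Finite R A := Module.Finite.of_basis pb.basis
  haveI : Module.Finite R (A ⧸ J) :=
    Module.Finite.of_surjective (Ideal.Quotient.mkₐ R J).toLinearMap (Ideal.Quotient.mkₐ_surjective R J)
  have hπalg : ∀ r : R, π (algebraMap R A r) = algebraMap R (A ⧸ J) r := fun r => by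
    rw [hπ, Ideal.Quotient.mk_algebraMap]
  have hIJ : I.map π = (maximalIdeal R).map (algebraMap R (A ⧸ J)) := by
    rw [hI, Ideal.map_map]
    congr 1
  have hxJ : π (x - algebraMap R A a₀) ∈ (maximalIdeal R).map (algebraMap R (A ⧸ J)) := by
    have h1 : π (x - algebraMap R A a₀) = π ((x - algebraMap R A a₀) * e) := by rw [map_mul, hπe, mul_one]
    rw [h1, ← hIJ]
    exact Ideal.mem_map_of_mem _ hxe
  have hsurj : Function.Surjective (algebraMap R (A ⧸ J)) := by
    set N : Submodule R (A ⧸ J) := LinearMap.range (Algebra.linearMap R (A ⧸ J)) with hN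
    suffices htop : (⊤ : Submodule R (A ⧸ J)) ≤ N by
      intro b
      obtain ⟨r, hr⟩ := LinearMap.mem_range.1 (htop (Submodule.mem_top : b ∈ ⊤))
      exact ⟨r, hr⟩
    refine Submodule.le_of_le_smul_of_le_jacobson_bot Module.Finite.fg_top (IsLocalRing.maximalIdeal_le_jacobson ⊥) ?_
    intro b _
    obtain ⟨z, rfl⟩ := Ideal.Quotient.mk_surjective b
    obtain ⟨p, rfl⟩ := AdjoinRoot.mk_surjective z
    obtain ⟨q, hq⟩ := X_sub_C_dvd_sub_C_eval (a := a₀) (p := p)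
    have hp : AdjoinRoot.mk f p = algebraMap R A (p.eval a₀) + (x - algebraMap R A a₀) * aeval x q := by
      have h1 : p = C (p.eval a₀) + (X - C a₀) * q := by rw [← hq]; ring
      conv_lhs => rw [h1, ← AdjoinRoot.aeval_eq]
      rw [map_add, map_mul, map_sub, aeval_C, aeval_X, aeval_C]
    change π (AdjoinRoot.mk f p) ∈ N ⊔ maximalIdeal R • ⊤
    rw [hp, map_add, map_mul, hπalg]
    refine Submodule.add_mem_sup ⟨p.eval a₀, rfl⟩ ?_
    rw [Ideal.smul_top_eq_map]
    exact Ideal.mul_mem_right _ _ hxJ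
  -- the root
  obtain ⟨a, ha⟩ := hsurj (π x)
  let φ : R ≃+* A ⧸ J := RingEquiv.ofBijective (algebraMap R (A ⧸ J)) ⟨hinj, hsurj⟩
  refine ⟨a, ?_, ?_⟩
  · have h1 : algebraMap R (A ⧸ J) (f.eval a) = 0 := by
      rw [← aeval_algebraMap_apply_eq_algebraMap_eval, ha, hπ, ← Ideal.Quotient.mkₐ_eq_mk R, aeval_algHom_apply, hfx,
        map_zero]
    exact (injective_iff_map_eq_zero _).1 hinj _ h1
  · have h1 : algebraMap R (A ⧸ J) (a - a₀) ∈ (maximalIdeal R).map (algebraMap R (A ⧸ J)) := by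
      rw [map_sub, ha, ← hπalg, ← map_sub]
      exact hxJ
    have h2 : ((maximalIdeal R).map (algebraMap R (A ⧸ J))).comap (algebraMap R (A ⧸ J)) = maximalIdeal R := by
      change ((maximalIdeal R).map (φ : R →+* A ⧸ J)).comap (φ : R →+* A ⧸ J) = maximalIdeal R
      exact Ideal.comap_map_of_bijective _ φ.bijective
    rw [← h2, Ideal.mem_comap]
    exact h1

/-! ## §2 Local module-finite algebras over a henselian local ring are henselian — Stacks 04GH -/

/-- **A LOCAL ring which is module-finite over a henselian local ring is henselian** [Stacks 04GH: «`S` is a finite product of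
henselian local rings», the factors being the local corners `S ⧸ (1 - e)`, each module-finite over `R`].  Proof: the criterion of §1
for `T`; idempotents of `T[X]/(f) ⧸ 𝔪_T` lift first to `T[X]/(f) ⧸ 𝔪_R` (the kernel is nilpotent because `𝔪_T^N ⊆ 𝔪_R T`, `T ⧸ 𝔪_R T`
being a local ARTINIAN ring) and then to `T[X]/(f)` by ★ `Henselian.exists_isIdempotentElem_mk_eq` (`T[X]/(f)` is module-finite
over the henselian `R`). [cite: StacksProject, Tag 04GH] -/
theorem henselianLocalRing_of_isLocalRing_of_moduleFinite (R : Type u) [CommRing R] [HenselianLocalRing R]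
    (T : Type v) [CommRing T] [Algebra R T] [Module.Finite R T] [IsLocalRing T] : HenselianLocalRing T := by
  classical
  refine henselianLocalRing_of_forall_exists_isIdempotentElem fun f hf => ?_
  -- `C = T[X]/(f)` is module-finite over `R`
  set C := AdjoinRoot f with hC
  haveI : Module.Finite T C := Module.Finite.of_basis (AdjoinRoot.powerBasis' hf).basis
  haveI : Module.Finite R C := Module.Finite.trans T C
  haveI : Algebra.IsIntegral R C := Algebra.IsIntegral.of_finite R C
  -- `𝔫 = 𝔪_T ⊇ J = 𝔪_R T`, and `𝔫 ^ N ≤ J` (the local artinian ring `T ⧸ J`)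
  set 𝔫 := maximalIdeal T with h𝔫
  set J : Ideal T := (maximalIdeal R).map (algebraMap R T) with hJ
  have hJ𝔫 : J ≤ 𝔫 := Literature.RingTheory.Idempotents.map_maximalIdeal_le_of_isMaximal (R := R) 𝔫 (maximalIdeal.isMaximal T)
  have hJtop : J ≠ ⊤ := fun h => (maximalIdeal.isMaximal T).ne_top (top_le_iff.1 (h ▸ hJ𝔫))
  haveI : Nontrivial (T ⧸ J) := Ideal.Quotient.nontrivial_iff.2 hJtop
  haveI := Literature.RingTheory.Idempotents.isArtinianRing_quotient (R := R) (A := T)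
  obtain ⟨N, hN⟩ := IsArtinianRing.isNilpotent_jacobson_bot (R := T ⧸ J)
  have h𝔫J : 𝔫 ^ N ≤ J := by
    have hle : 𝔫.map (Ideal.Quotient.mk J) ≤ Ideal.jacobson (⊥ : Ideal (T ⧸ J)) := by
      refine le_sInf fun M hM => ?_
      haveI := hM.2
      have hcm : M.comap (Ideal.Quotient.mk J) = 𝔫 :=
        IsLocalRing.eq_maximalIdeal (Ideal.comap_isMaximal_of_surjective _ Ideal.Quotient.mk_surjective)
      rw [← hcm, Ideal.map_comap_of_surjective _ Ideal.Quotient.mk_surjective]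
    have h0 : (𝔫 ^ N).map (Ideal.Quotient.mk J) = ⊥ := by
      rw [Ideal.map_pow, ← le_bot_iff, ← Ideal.zero_eq_bot, ← hN]
      exact Ideal.pow_right_mono hle N
    rw [← Ideal.mk_ker (I := J)]
    exact (Ideal.map_eq_bot_iff_le_ker _).1 h0
  -- the two ideals of `C`: `I_T = 𝔪_T C ⊇ I_R = 𝔪_R C ⊇ I_T ^ N`
  set IT : Ideal C := 𝔫.map (algebraMap T C) with hIT
  set IR : Ideal C := (maximalIdeal R).map (algebraMap R C) with hIR
  have hIRJ : IR = J.map (algebraMap T C) := by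
    rw [hIR, hJ, Ideal.map_map, ← IsScalarTower.algebraMap_eq R T C]
  have hRT : IR ≤ IT := by rw [hIRJ]; exact Ideal.map_mono hJ𝔫
  have hTR : IT ^ N ≤ IR := by rw [hIRJ, hIT, ← Ideal.map_pow]; exact Ideal.map_mono h𝔫J
  intro ē hē
  -- step 1: lift `ē` along `C ⧸ I_R → C ⧸ I_T` (nilpotent kernel)
  set g : C ⧸ IR →+* C ⧸ IT := Ideal.Quotient.factor hRT with hg
  have hgnil : ∀ z ∈ RingHom.ker g, IsNilpotent z := by
    intro z hz
    obtain ⟨c, rfl⟩ := Ideal.Quotient.mk_surjective z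
    rw [RingHom.mem_ker, hg, Ideal.Quotient.factor_mk, Ideal.Quotient.eq_zero_iff_mem] at hz
    refine ⟨N, ?_⟩
    rw [← map_pow, Ideal.Quotient.eq_zero_iff_mem]
    exact hTR (Ideal.pow_mem_pow hz N)
  have hrange : ē ∈ g.range := by
    obtain ⟨c, hc⟩ := Ideal.Quotient.mk_surjective ē
    exact ⟨Ideal.Quotient.mk IR c, by rw [hg, Ideal.Quotient.factor_mk]; exact hc⟩
  obtain ⟨ē₁, hē₁, hgē₁⟩ := exists_isIdempotentElem_eq_of_ker_isNilpotent g hgnil ē hrange hē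
  -- step 2: lift along `C → C ⧸ I_R` by the henselian property of `R`
  obtain ⟨e₁, he₁, hmk⟩ := exists_isIdempotentElem_mk_eq (R := R) (S := C) ē₁ hē₁
  refine ⟨e₁, he₁, ?_⟩
  rw [← hgē₁, ← hmk, hg, Ideal.Quotient.factor_mk]

/-- **The local corners of a finite algebra over a henselian local ring are henselian** [Stacks 04GH]: for `S` module-finite
over the henselian local `R` and `e ∈ S` with `S ⧸ (1 - e)` local, the corner `S ⧸ (1 - e)` is a henselian local ring.
[cite: StacksProject, Tag 04GH] -/
theorem henselianLocalRing_quotient_span_one_sub (R : Type u) [CommRing R] [HenselianLocalRing R] {S : Type v}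
    [CommRing S] [Algebra R S] [Module.Finite R S] (e : S) [IsLocalRing (S ⧸ Ideal.span {1 - e})] :
    HenselianLocalRing (S ⧸ Ideal.span {1 - e}) :=
  haveI : Module.Finite R (S ⧸ Ideal.span {1 - e}) :=
    Module.Finite.of_surjective (Ideal.Quotient.mkₐ R (Ideal.span {1 - e})).toLinearMap
      (Ideal.Quotient.mkₐ_surjective R _)
  henselianLocalRing_of_isLocalRing_of_moduleFinite R (S ⧸ Ideal.span {1 - e})

/-- **A finite algebra over a henselian local ring is a finite product of HENSELIAN local rings** [Stacks 04GH]: complete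
orthogonal idempotents `e_1, …, e_n ∈ S` with every corner `S ⧸ (1 - e_i)` a henselian local ring (so `S ≃ Π_i S ⧸ (1 - e_i)` by
Mathlib's `CompleteOrthogonalIdempotents.bijective_pi`). [cite: StacksProject, Tag 04GH] -/
theorem exists_completeOrthogonalIdempotents_henselianLocalRing (R : Type u) [CommRing R] [HenselianLocalRing R]
    {S : Type v} [CommRing S] [Algebra R S] [Module.Finite R S] :
    ∃ (n : ℕ) (e : Fin n → S), CompleteOrthogonalIdempotents e ∧ ∀ i, HenselianLocalRing (S ⧸ Ideal.span {1 - e i}) := by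
  obtain ⟨n, e, he, hloc⟩ := exists_completeOrthogonalIdempotents_isLocalRing R (S := S)
  exact ⟨n, e, he, fun i => by haveI := hloc i; exact henselianLocalRing_quotient_span_one_sub R (e i)⟩

end Literature.RingTheory.Henselian

end
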